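import Summits.ValiantsHypothesis.ValiantsHypothesis.Theorems.LacunarySymmetroidMatrixDescartesCensusEdgeThreeNine
import Summits.ValiantsHypothesis.ValiantsHypothesis.Theorems.LacunarySymmetroidMatrixDescartesCensusLaguerreSum

/-!
# `MatrixDescartes` census — W4: the RUNS LEMMA (Rolle for `R − p²` across the zeros of `p`) and THEOREM R3b: edge `2..9` dead, in the kernel

HONEST FRAMING.  Object-search cell `pub-symmetroid`, item `DoorA26 = PosRootLawAt 2 6 19` (stmt-ValiantsHypothesis-19979,
OPEN, typed, never asserted).  W4 line (engine-1 g17–g21): degenerations of HYPOTHETICAL Descartes-sharp symmetric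
`2 × 2` six-term pencils.  On chamber 1706 (pair-sum order of `(0,2,3,7,16,27)`; here only `d₁ < d₂`, `2d₂ < d₃` is used)
a degeneration direction in a face containing the elbows `2` and `9` but not `3` has the hull edge `2..9`: eight Gram
entries `b₀₂, q₁₁, b₁₂, q₂₂, b₀₃, b₁₃, b₂₃, q₃₃` at `d₂ < 2d₁ < d₁+d₂ < 2d₂ < d₃ < d₁+d₃ < d₂+d₃ < 2d₃` with the `{1,2,3}`
block of rank one, i.e. `F = σ·p² + 2b₀₂X^{d₂} + 2b₀₃X^{d₃}`, `p = y₁X^{d₁} + y₂X^{d₂} + y₃X^{d₃}`, cell signs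
`σ < 0 < b₀₂, b₀₃`, `y₁y₂ < 0 < y₁y₃`; sharpness would need `7 = #terms − 1` positive roots with multiplicity
(seat note TROPFAN-W4-E1G17, ADDENDUM rev 2 (R3b): `≤ 6` by `φ = p/√R`).  This file proves `#Z₊^{mult}(F) ≤ 5 < 7`
by a square-root-free RUNS LEMMA: for real polynomials `R, p` with `R > 0` on `(0,∞)`,
`#Z₊^{mult}(R − p²) ≤ #Z₊^{mult}(W) + #Z₊^{mult}(p) + 1`, `W = p·R′ − 2R·p′` (`= p·F′ − 2p′·F`, a Wronskian-type
twist: Rolle for `F/p²` between consecutive roots of `F` not separated by a root of `p`, the roots of `p` serving as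
the other separators; multiplicities transfer through the identity).  On the edge, `X·W` is a 5-nomial with sign
blocks `(∓ | +, + | −, −)` (`Var ≤ 2`, the tree's block bound) and `p` is a trinomial (`≤ 2`), so `≤ 2 + 2 + 1 = 5`.
Mirror statement (edge `11..18` on chamber 954) by `d ↦ −d` bookkeeping, not typed here.  Nothing here bounds
`ζ_sym(2,6)`, decides `DoorA26`, or bears on the crux `MatrixDescartes` (stmt-ValiantsHypothesis-18050) / `VP ≠ VNP`:
a dead channel is a statement about hypothetical objects.

[folklore] Rolle with multiplicity for `F/p²` + Descartes' bound by sign blocks; no single source.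
-/

-- `Summit.ValiantsHypothesis.ValiantsHypothesis.…` repeats a component by the D-0017 layout
-- (single-conjunct summit), which the `dupNamespace` linter flags; the name is mandated.
set_option linter.dupNamespace false

namespace Summit.ValiantsHypothesis.ValiantsHypothesis.Theorems.LacunarySymmetroidMatrixDescartes.Census

open Polynomial Finset Set
open scoped BigOperators Polynomial

/-! ### The Wronskian-type twist `W = p·R′ − 2R·p′ = p·(R − p²)′ − 2p′·(R − p²)` -/

/-- **Twist identity**: `p·(R − p²)′ − 2·p′·(R − p²) = p·R′ − 2·R·p′`. [folklore] -/
theorem sqTwist_identity (R p : ℝ[X]) :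
    p * derivative (R - p ^ 2) - 2 * derivative p * (R - p ^ 2) = p * derivative R - 2 * R * derivative p := by
  rw [sq, derivative_sub, derivative_mul]
  ring

/-- A root of multiplicity `m` of `R − p²` is a root of multiplicity at least `m − 1` of `W = p·R′ − 2R·p′`. [folklore] -/
theorem rootMultiplicity_le_sqTwist_succ (R p : ℝ[X]) (x : ℝ) (hW : p * derivative R - 2 * R * derivative p ≠ 0) :
    (R - p ^ 2).rootMultiplicity x ≤ (p * derivative R - 2 * R * derivative p).rootMultiplicity x + 1 := by
  have h1 : (X - C x) ^ ((R - p ^ 2).rootMultiplicity x - 1) ∣ derivative (R - p ^ 2) := by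
    rcases eq_or_ne (derivative (R - p ^ 2)) 0 with hd | hd
    · rw [hd]; exact dvd_zero _
    · exact (le_rootMultiplicity_iff hd).mp (rootMultiplicity_sub_one_le_derivative_rootMultiplicity _ x)
  have h2 : (X - C x) ^ ((R - p ^ 2).rootMultiplicity x - 1) ∣ (R - p ^ 2) :=
    (pow_dvd_pow _ (Nat.sub_le _ _)).trans (pow_rootMultiplicity_dvd _ x)
  have h3 : (X - C x) ^ ((R - p ^ 2).rootMultiplicity x - 1) ∣ p * derivative R - 2 * R * derivative p := by
    rw [← sqTwist_identity]
    exact dvd_sub (dvd_mul_of_dvd_right h1 _) (dvd_mul_of_dvd_right h2 _)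
  have := (le_rootMultiplicity_iff hW).mpr h3
  omega

/-! ### The RUNS LEMMA -/

/-- Runs lemma, variable form (`F = R − p²`, `W = p·R′ − 2R·p′` as named polynomials). [folklore] -/
theorem countP_posRoots_sub_sq_le_aux (R p F W : ℝ[X]) (hFdef : F = R - p ^ 2)
    (hWdef : W = p * derivative R - 2 * R * derivative p) (hR : ∀ x : ℝ, 0 < x → 0 < R.eval x) (hW : W ≠ 0) :
    F.roots.countP (fun x => 0 < x) ≤ W.roots.countP (fun x => 0 < x) + p.roots.countP (fun x => 0 < x) + 1 := by
  classical
  have hp : p ≠ 0 := by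
    rintro rfl
    apply hW
    rw [hWdef]; simp
  have hG : W * p ≠ 0 := mul_ne_zero hW hp
  -- multiplicities
  have hmult : ∀ x ∈ F.roots.toFinset.filter (fun x => 0 < x),
      F.rootMultiplicity x ≤ (W * p).rootMultiplicity x + 1 := by
    intro x _
    rw [rootMultiplicity_mul hG]
    have hW' : p * derivative R - 2 * R * derivative p ≠ 0 := by rwa [← hWdef]
    have := rootMultiplicity_le_sqTwist_succ R p x hW'
    rw [← hFdef, ← hWdef] at this
    omega
  rcases eq_or_ne F 0 with hF0 | hF0
  · rw [hF0, roots_zero]; simp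
  -- interleaving
  have hinter : (F.roots.toFinset.filter (fun x => 0 < x)).card ≤
      (((W * p).roots.toFinset.filter (fun x => 0 < x)) \ (F.roots.toFinset.filter (fun x => 0 < x))).card + 1 := by
    refine Finset.card_le_sdiff_of_interleaved fun a ha b hb hab _ => ?_
    simp only [Finset.mem_filter, Multiset.mem_toFinset, mem_roots hF0, IsRoot.def] at ha hb
    obtain ⟨hFa, ha0⟩ := ha
    obtain ⟨hFb, hb0⟩ := hb
    -- target membership, unfolded
    have goal_of : ∀ z, a < z → z < b → (W.eval z = 0 ∨ p.eval z = 0) →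
        ∃ z ∈ (W * p).roots.toFinset.filter (fun x => 0 < x), a < z ∧ z < b := by
      intro z haz hzb hz
      refine ⟨z, ?_, haz, hzb⟩
      simp only [Finset.mem_filter, Multiset.mem_toFinset, mem_roots hG, IsRoot.def, eval_mul]
      refine ⟨?_, ha0.trans haz⟩
      rcases hz with h | h
      · rw [h, zero_mul]
      · rw [h, mul_zero]
    by_cases hpz : ∃ z, a < z ∧ z < b ∧ p.eval z = 0
    · obtain ⟨z, haz, hzb, hz⟩ := hpz
      exact goal_of z haz hzb (Or.inr hz)
    · push Not at hpz
      -- `p ≠ 0` on `[a, b]`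
      have hFeval : ∀ u, F.eval u = R.eval u - p.eval u ^ 2 := by
        intro u; rw [hFdef, eval_sub, eval_pow]
      have hpa : p.eval a ≠ 0 := by
        intro h0
        have h1 := hFeval a
        rw [hFa, h0] at h1
        have h2 := hR a ha0
        nlinarith
      have hpb : p.eval b ≠ 0 := by
        intro h0
        have h1 := hFeval b
        rw [hFb, h0] at h1
        have h2 := hR b hb0
        nlinarith
      have hpne : ∀ u ∈ Icc a b, p.eval u ≠ 0 := by
        intro u hu
        rcases eq_or_lt_of_le hu.1 with h | h
        · rw [← h]; exact hpa
        rcases eq_or_lt_of_le hu.2 with h' | h'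
        · rw [h']; exact hpb
        exact hpz u h h'
      -- Rolle for `φ = F / p²` on `[a, b]`
      have hder : ∀ u ∈ Ioo a b, HasDerivAt (fun u => F.eval u * (p.eval u ^ 2)⁻¹)
          ((derivative F).eval u * (p.eval u ^ 2)⁻¹ +
            F.eval u * (-(((2 : ℕ) : ℝ) * p.eval u ^ (2 - 1) * (derivative p).eval u) / (p.eval u ^ 2) ^ 2)) u := by
        intro u hu
        have hpu : p.eval u ≠ 0 := hpne u ⟨hu.1.le, hu.2.le⟩
        refine (F.hasDerivAt u).mul ?_
        exact ((p.hasDerivAt u).pow 2).inv (pow_ne_zero 2 hpu)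
      have hcont : ContinuousOn (fun u => F.eval u * (p.eval u ^ 2)⁻¹) (Icc a b) := by
        refine F.continuousOn.mul ((p.continuousOn.pow 2).inv₀ ?_)
        intro u hu; exact pow_ne_zero 2 (hpne u hu)
      obtain ⟨z, hz, hz0⟩ := exists_hasDerivAt_eq_zero hab hcont (by simp [hFa, hFb]) hder
      have hpz0 : p.eval z ≠ 0 := hpne z ⟨hz.1.le, hz.2.le⟩
      refine goal_of z hz.1 hz.2 (Or.inl ?_)
      -- from `φ′(z) = 0`: `p(z)·F′(z) − 2·p′(z)·F(z) = 0`, i.e. `W(z) = 0`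
      have key : (derivative F).eval z * p.eval z - 2 * (derivative p).eval z * F.eval z = 0 := by
        have hp2 : p.eval z ^ 2 ≠ 0 := pow_ne_zero 2 hpz0
        have e : ((derivative F).eval z * (p.eval z ^ 2)⁻¹ +
            F.eval z * (-(((2 : ℕ) : ℝ) * p.eval z ^ (2 - 1) * (derivative p).eval z) / (p.eval z ^ 2) ^ 2))
              * (p.eval z) ^ 3
            = (derivative F).eval z * p.eval z - 2 * (derivative p).eval z * F.eval z := by
          field_simp
          ring
        rw [hz0, zero_mul] at e
        exact e.symm
      have hWz : W = p * derivative F - 2 * derivative p * F := by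
        rw [hWdef, hFdef, sqTwist_identity]
      rw [hWz, eval_sub, eval_mul, eval_mul, eval_mul, eval_ofNat]
      linarith [key]
  have main := countP_posRoots_add_le_of_interleaved F (W * p) hG 0 hmult (by rw [add_zero]; exact hinter)
  rw [add_zero, roots_mul hG, Multiset.countP_add] at main
  exact main

/-- **RUNS LEMMA (Rolle for `R − p²` across the zeros of `p`), with multiplicity.**  Let `R, p` be real polynomials
with `R > 0` on `(0, ∞)` and `W = p·R′ − 2R·p′ ≠ 0`.  Then
`#Z₊^{mult}(R − p²) ≤ #Z₊^{mult}(W) + #Z₊^{mult}(p) + 1`.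
Between two consecutive positive roots of `F = R − p²` lies either a root of `p` or — when `p ≠ 0` on the closed
interval (at the end points `p² = R > 0`) — a critical point of `F/p²`, i.e. a root of `W` (`(F/p²)′ = W/p³`); a
root of `F` of multiplicity `m` is a root of `W` of multiplicity `≥ m − 1`. [folklore] -/
theorem countP_posRoots_sub_sq_le (R p : ℝ[X]) (hR : ∀ x : ℝ, 0 < x → 0 < R.eval x)
    (hW : p * derivative R - 2 * R * derivative p ≠ 0) :
    (R - p ^ 2).roots.countP (fun x => 0 < x) ≤
      (p * derivative R - 2 * R * derivative p).roots.countP (fun x => 0 < x)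
        + p.roots.countP (fun x => 0 < x) + 1 :=
  countP_posRoots_sub_sq_le_aux R p _ _ rfl rfl hR hW

/-! ### A sign-block count -/

/-- **Three sign blocks ⇒ at most two sign variations.**  A real polynomial whose coefficients live at five
exponents `e₀ < e₁ ≤ e₂ < e₃ ≤ e₄` with weights `w₀` (any sign), `w₁, w₂ ≥ 0`, `w₃, w₄ ≤ 0` has `Var ≤ 2`
(the tree's block bound `signVariations_succ_le_of_blocks` with the blocks `[0,e₁) | [e₁,e₃) | [e₃,e₄]`). [folklore] -/
theorem signVariations_le_two_of_three_blocks (Q : ℝ[X]) (e₀ e₁ e₂ e₃ e₄ : ℕ) (w₀ w₁ w₂ w₃ w₄ : ℝ)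
    (h01 : e₀ < e₁) (h12 : e₁ ≤ e₂) (h23 : e₂ < e₃) (h34 : e₃ ≤ e₄)
    (hcoeff : ∀ m, Q.coeff m = (if m = e₀ then w₀ else 0) + (if m = e₁ then w₁ else 0)
      + (if m = e₂ then w₂ else 0) + (if m = e₃ then w₃ else 0) + (if m = e₄ then w₄ else 0))
    (hw₁ : 0 ≤ w₁) (hw₂ : 0 ≤ w₂) (hw₃ : w₃ ≤ 0) (hw₄ : w₄ ≤ 0) (hdeg : Q.natDegree < e₄ + 1) :
    Q.signVariations ≤ 2 := by
  have key := signVariations_succ_le_of_blocks 3 Q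
    (fun k => if k < 1 then 0 else if k < 2 then e₁ else if k < 3 then e₃ else e₄ + 1) (if_pos (by norm_num)) ?_ ?_ ?_
  · omega
  · refine monotone_nat_of_le_succ fun k => ?_
    rcases Nat.lt_or_ge k 3 with hk | hk
    · interval_cases k
      · simp
      · simp; omega
      · simp; omega
    · simp only [if_neg (show ¬ k < 1 by omega), if_neg (show ¬ k < 2 by omega), if_neg (show ¬ k < 3 by omega),
        if_neg (show ¬ k + 1 < 1 by omega), if_neg (show ¬ k + 1 < 2 by omega), if_neg (show ¬ k + 1 < 3 by omega)]
      exact le_rfl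
  · simp only [show ¬ (3 : ℕ) < 1 by norm_num, show ¬ (3 : ℕ) < 2 by norm_num, lt_irrefl, if_false]
    exact hdeg
  · intro i hi
    interval_cases i
    · refine ⟨if 0 ≤ w₀ then 1 else -1, by split_ifs <;> simp, fun m _ hm2 => ?_⟩
      simp only [show (0 : ℕ) + 1 < 2 by norm_num, show ¬ (0 : ℕ) + 1 < 1 by norm_num, if_true, if_false] at hm2
      rw [hcoeff m, if_neg (show m ≠ e₁ by omega), if_neg (show m ≠ e₂ by omega),
        if_neg (show m ≠ e₃ by omega), if_neg (show m ≠ e₄ by omega)]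
      split_ifs <;> nlinarith
    · refine ⟨1, Or.inl rfl, fun m hm1 hm2 => ?_⟩
      simp only [show (1 : ℕ) < 2 by norm_num, show ¬ (1 : ℕ) < 1 by norm_num, if_true, if_false] at hm1
      simp only [show ¬ (1 : ℕ) + 1 < 2 by norm_num, show ¬ (1 : ℕ) + 1 < 1 by norm_num, show (1:ℕ) + 1 < 3 by norm_num, if_true, if_false] at hm2
      rw [hcoeff m, if_neg (show m ≠ e₀ by omega), if_neg (show m ≠ e₃ by omega),
        if_neg (show m ≠ e₄ by omega)]
      split_ifs <;> nlinarith
    · refine ⟨-1, Or.inr rfl, fun m hm1 _ => ?_⟩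
      simp only [show ¬ (2 : ℕ) < 2 by norm_num, show ¬ (2 : ℕ) < 1 by norm_num, show (2:ℕ) < 3 by norm_num, if_true, if_false] at hm1
      rw [hcoeff m, if_neg (show m ≠ e₀ by omega), if_neg (show m ≠ e₁ by omega),
        if_neg (show m ≠ e₂ by omega)]
      split_ifs <;> nlinarith

/-! ### THEOREM R3b: the hull edge `2..9` -/

/-- The 5-nomial `X·W` of the edge `2..9` (`R = β₂X^{d₂} + β₃X^{d₃}`, `p = y₁X^{d₁} + y₂X^{d₂} + y₃X^{d₃}`). [folklore] -/
theorem X_mul_sqTwist_edge_2_9 (d₁ d₂ d₃ : ℕ) (β₂ β₃ y₁ y₂ y₃ : ℝ) :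
    X * ((C y₁ * X ^ d₁ + C y₂ * X ^ d₂ + C y₃ * X ^ d₃) * derivative (C β₂ * X ^ d₂ + C β₃ * X ^ d₃)
        - 2 * (C β₂ * X ^ d₂ + C β₃ * X ^ d₃) * derivative (C y₁ * X ^ d₁ + C y₂ * X ^ d₂ + C y₃ * X ^ d₃))
      = C (β₂ * y₁ * ((d₂ : ℝ) - 2 * d₁)) * X ^ (d₁ + d₂) + C (-(β₂ * y₂ * (d₂ : ℝ))) * X ^ (2 * d₂)
        + C (β₃ * y₁ * ((d₃ : ℝ) - 2 * d₁)) * X ^ (d₁ + d₃)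
        + C (β₃ * y₂ * ((d₃ : ℝ) - 2 * d₂) + β₂ * y₃ * ((d₂ : ℝ) - 2 * d₃)) * X ^ (d₂ + d₃)
        + C (-(β₃ * y₃ * (d₃ : ℝ))) * X ^ (2 * d₃) := by
  have e1 := Literature.Analysis.FluidPDE.Elgindi.X_mul_derivative_X_pow d₁
  have e2 := Literature.Analysis.FluidPDE.Elgindi.X_mul_derivative_X_pow d₂
  have e3 := Literature.Analysis.FluidPDE.Elgindi.X_mul_derivative_X_pow d₃
  have hR : X * derivative (C β₂ * X ^ d₂ + C β₃ * X ^ d₃ : ℝ[X])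
      = C β₂ * (C (d₂ : ℝ) * X ^ d₂) + C β₃ * (C (d₃ : ℝ) * X ^ d₃) := by
    rw [← e2, ← e3]; simp only [derivative_add, derivative_C_mul]; ring
  have hp : X * derivative (C y₁ * X ^ d₁ + C y₂ * X ^ d₂ + C y₃ * X ^ d₃ : ℝ[X])
      = C y₁ * (C (d₁ : ℝ) * X ^ d₁) + C y₂ * (C (d₂ : ℝ) * X ^ d₂) + C y₃ * (C (d₃ : ℝ) * X ^ d₃) := by
    rw [← e1, ← e2, ← e3]; simp only [derivative_add, derivative_C_mul]; ring
  calc X * ((C y₁ * X ^ d₁ + C y₂ * X ^ d₂ + C y₃ * X ^ d₃) * derivative (C β₂ * X ^ d₂ + C β₃ * X ^ d₃)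
        - 2 * (C β₂ * X ^ d₂ + C β₃ * X ^ d₃) * derivative (C y₁ * X ^ d₁ + C y₂ * X ^ d₂ + C y₃ * X ^ d₃))
      = (C y₁ * X ^ d₁ + C y₂ * X ^ d₂ + C y₃ * X ^ d₃) * (X * derivative (C β₂ * X ^ d₂ + C β₃ * X ^ d₃))
        - 2 * (C β₂ * X ^ d₂ + C β₃ * X ^ d₃) * (X * derivative (C y₁ * X ^ d₁ + C y₂ * X ^ d₂ + C y₃ * X ^ d₃)) := by
        ring
    _ = _ := by
        rw [hR, hp]
        simp only [map_add, map_mul, map_sub, map_neg, pow_add, two_mul]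
        ring

/-- **THEOREM R3b (edge `2..9` dead, chamber-uniform).**  For all exponents `d₁ < d₂`, `2d₂ < d₃` and all real letters
with the cell's signs `σ < 0 < b₂, b₃`, `y₁ > 0 > y₂`, `y₃ > 0`, the 8-term hull-edge form
`F = σ·(y₁X^{d₁} + y₂X^{d₂} + y₃X^{d₃})² + 2b₂X^{d₂} + 2b₃X^{d₃}` has at most `5 < 7 = #terms − 1` positive roots
COUNTED WITH MULTIPLICITY — so no hypothetical twenty on a chamber-1706 support degenerates in a direction whose hull has
the edge `2..9` (faces `∋ {2, 9}`, `∌ 3` of `C₇`; mirror on 954).  (For the sign-flipped triple `y ↦ −y` use `(−p)² = p²`: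
`countP_posRoots_zp_2_9_le'`.) [folklore] -/
theorem countP_posRoots_zp_2_9_le (d₁ d₂ d₃ : ℕ) (h₁ : d₁ < d₂) (h₃ : 2 * d₂ < d₃) (σ b₂ b₃ y₁ y₂ y₃ : ℝ)
    (hσ : σ < 0) (hb₂ : 0 < b₂) (hb₃ : 0 < b₃) (hy₁ : 0 < y₁) (hy₂ : y₂ < 0) (hy₃ : 0 < y₃) :
    ((C σ * (C y₁ * X ^ d₁ + C y₂ * X ^ d₂ + C y₃ * X ^ d₃) ^ 2 + C (2 * b₂) * X ^ d₂ + C (2 * b₃) * X ^ d₃ :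
      ℝ[X]).roots.countP (fun x => 0 < x)) ≤ 5 := by
  classical
  have hσ' : 0 < -σ := neg_pos.mpr hσ
  -- the letters of the normal form `R − p²`
  obtain ⟨β₂, hβ₂⟩ : ∃ β : ℝ, β = 2 * b₂ / (-σ) := ⟨_, rfl⟩
  obtain ⟨β₃, hβ₃⟩ : ∃ β : ℝ, β = 2 * b₃ / (-σ) := ⟨_, rfl⟩
  have hβ₂p : 0 < β₂ := by rw [hβ₂]; exact div_pos (by linarith) hσ'
  have hβ₃p : 0 < β₃ := by rw [hβ₃]; exact div_pos (by linarith) hσ'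
  obtain ⟨p, hpdef⟩ : ∃ q : ℝ[X], q = C y₁ * X ^ d₁ + C y₂ * X ^ d₂ + C y₃ * X ^ d₃ := ⟨_, rfl⟩
  obtain ⟨R, hRdef⟩ : ∃ q : ℝ[X], q = C β₂ * X ^ d₂ + C β₃ * X ^ d₃ := ⟨_, rfl⟩
  -- normalisation: `σ p² + 2b₂X^{d₂} + 2b₃X^{d₃} = (−σ)·(R − p²)`
  have hnorm : (C σ * (C y₁ * X ^ d₁ + C y₂ * X ^ d₂ + C y₃ * X ^ d₃) ^ 2 + C (2 * b₂) * X ^ d₂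
      + C (2 * b₃) * X ^ d₃ : ℝ[X]) = C (-σ) * (R - p ^ 2) := by
    have e2 : C (-σ) * C β₂ = (C (2 * b₂) : ℝ[X]) := by
      rw [← C_mul, hβ₂, mul_div_cancel₀ _ hσ'.ne']
    have e3 : C (-σ) * C β₃ = (C (2 * b₃) : ℝ[X]) := by
      rw [← C_mul, hβ₃, mul_div_cancel₀ _ hσ'.ne']
    have eσ : (C σ : ℝ[X]) = -C (-σ) := by rw [map_neg, neg_neg]
    rw [hRdef, ← hpdef, eσ]
    linear_combination (X ^ d₂) * e2.symm + (X ^ d₃) * e3.symm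
  rw [hnorm, countP_posRoots_C_mul _ hσ'.ne']
  -- `R > 0` on `(0, ∞)`
  have hRpos : ∀ x : ℝ, 0 < x → 0 < R.eval x := by
    intro x hx
    rw [hRdef, eval_add, eval_mul, eval_mul, eval_C, eval_C, eval_pow, eval_pow, eval_X]
    positivity
  -- the twist `W` and the 5-nomial `X·W`
  obtain ⟨W, hWdef⟩ : ∃ q : ℝ[X], q = p * derivative R - 2 * R * derivative p := ⟨_, rfl⟩
  have hXW := X_mul_sqTwist_edge_2_9 d₁ d₂ d₃ β₂ β₃ y₁ y₂ y₃
  rw [← hpdef, ← hRdef, ← hWdef] at hXW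
  -- signs of the coefficients of `X·W`
  have rd₂ : (0 : ℝ) < d₂ := by exact_mod_cast (show 0 < d₂ by omega)
  have rd₃ : (0 : ℝ) < d₃ := by exact_mod_cast (show 0 < d₃ by omega)
  have r31 : (0 : ℝ) < (d₃ : ℝ) - 2 * d₁ := by
    have : (2 * d₁ : ℝ) < d₃ := by exact_mod_cast (show 2 * d₁ < d₃ by omega)
    linarith
  have r32 : (0 : ℝ) < (d₃ : ℝ) - 2 * d₂ := by
    have : (2 * d₂ : ℝ) < d₃ := by exact_mod_cast h₃
    linarith
  have r23 : (d₂ : ℝ) - 2 * d₃ < 0 := by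
    have : (d₂ : ℝ) < 2 * d₃ := by exact_mod_cast (show d₂ < 2 * d₃ by omega)
    linarith
  have hw₁p : 0 < -(β₂ * y₂ * (d₂ : ℝ)) := by
    have := mul_pos (mul_pos hβ₂p (neg_pos.mpr hy₂)) rd₂
    linarith
  have hw₂p : 0 < β₃ * y₁ * ((d₃ : ℝ) - 2 * d₁) := mul_pos (mul_pos hβ₃p hy₁) r31
  have hw₃n : β₃ * y₂ * ((d₃ : ℝ) - 2 * d₂) + β₂ * y₃ * ((d₂ : ℝ) - 2 * d₃) < 0 := by
    have t1 : β₃ * y₂ * ((d₃ : ℝ) - 2 * d₂) < 0 :=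
      mul_neg_of_neg_of_pos (mul_neg_of_pos_of_neg hβ₃p hy₂) r32
    have t2 : β₂ * y₃ * ((d₂ : ℝ) - 2 * d₃) < 0 := mul_neg_of_pos_of_neg (mul_pos hβ₂p hy₃) r23
    linarith
  have hw₄n : -(β₃ * y₃ * (d₃ : ℝ)) < 0 := by
    have := mul_pos (mul_pos hβ₃p hy₃) rd₃
    linarith
  have hcoeff : ∀ m, (X * W).coeff m = (if m = d₁ + d₂ then β₂ * y₁ * ((d₂ : ℝ) - 2 * d₁) else 0)
      + (if m = 2 * d₂ then -(β₂ * y₂ * (d₂ : ℝ)) else 0)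
      + (if m = d₁ + d₃ then β₃ * y₁ * ((d₃ : ℝ) - 2 * d₁) else 0)
      + (if m = d₂ + d₃ then β₃ * y₂ * ((d₃ : ℝ) - 2 * d₂) + β₂ * y₃ * ((d₂ : ℝ) - 2 * d₃) else 0)
      + (if m = 2 * d₃ then -(β₃ * y₃ * (d₃ : ℝ)) else 0) := by
    intro m
    rw [hXW]
    simp only [coeff_add, coeff_C_mul, coeff_X_pow, mul_ite, mul_one, mul_zero]
  -- `W ≠ 0` (top coefficient of `X·W`)
  have hXW0 : X * W ≠ 0 := by
    intro h0
    have := hcoeff (2 * d₃)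
    rw [h0, coeff_zero, if_neg (by omega), if_neg (by omega), if_neg (by omega), if_neg (by omega), if_pos rfl] at this
    linarith
  have hW0 : W ≠ 0 := fun h => hXW0 (by rw [h, mul_zero])
  -- `Var(X·W) ≤ 2` by three weakly one-signed blocks `[0, 2d₂) | [2d₂, d₂+d₃) | [d₂+d₃, 2d₃+1)`
  have hdeg : (X * W).natDegree < 2 * d₃ + 1 := by
    rw [Nat.lt_succ_iff, hXW]
    refine (natDegree_add_le _ _).trans (max_le ((natDegree_add_le _ _).trans (max_le
      ((natDegree_add_le _ _).trans (max_le ((natDegree_add_le _ _).trans (max_le ?_ ?_)) ?_)) ?_)) ?_)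
    all_goals exact (natDegree_C_mul_X_pow_le _ _).trans (by omega)
  have hvar : (X * W).signVariations ≤ 2 :=
    signVariations_le_two_of_three_blocks (X * W) (d₁ + d₂) (2 * d₂) (d₁ + d₃) (d₂ + d₃) (2 * d₃) _ _ _ _ _
      (by omega) (by omega) (by omega) (by omega) hcoeff hw₁p.le hw₂p.le hw₃n.le hw₄n.le hdeg
  have hZW : W.roots.countP (fun x => 0 < x) ≤ 2 := by
    have h1 : W.roots.countP (fun x => 0 < x) = (X * W).roots.countP (fun x => 0 < x) := by
      rw [← countP_posRoots_X_pow_mul W 1, pow_one]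
    rw [h1]
    have := roots_countP_pos_le_signVariations (X * W)
    omega
  -- `p` is a trinomial
  have hp0 : p ≠ 0 := by
    intro h
    apply hW0
    rw [hWdef, h]; simp
  have hZp : p.roots.countP (fun x => 0 < x) ≤ 2 := by
    have := countP_posRoots_lt_card_support hp0
    have h3 : p.support.card ≤ 3 := by
      rw [hpdef]
      exact (Finset.card_le_card (support_trinomial_subset d₁ d₂ d₃ y₁ y₂ y₃)).trans Finset.card_le_three
    omega
  have runs := countP_posRoots_sub_sq_le_aux R p (R - p ^ 2) W rfl hWdef hRpos hW0
  omega

/-- **THEOREM R3b, sign-flipped triple** (`y₁ < 0 < y₂`, `y₃ < 0`): same bound, since `F` only sees `p²`. [folklore] -/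
theorem countP_posRoots_zp_2_9_le' (d₁ d₂ d₃ : ℕ) (h₁ : d₁ < d₂) (h₃ : 2 * d₂ < d₃) (σ b₂ b₃ y₁ y₂ y₃ : ℝ)
    (hσ : σ < 0) (hb₂ : 0 < b₂) (hb₃ : 0 < b₃) (hy₁ : y₁ < 0) (hy₂ : 0 < y₂) (hy₃ : y₃ < 0) :
    ((C σ * (C y₁ * X ^ d₁ + C y₂ * X ^ d₂ + C y₃ * X ^ d₃) ^ 2 + C (2 * b₂) * X ^ d₂ + C (2 * b₃) * X ^ d₃ :
      ℝ[X]).roots.countP (fun x => 0 < x)) ≤ 5 := by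
  have hsq : ((C y₁ * X ^ d₁ + C y₂ * X ^ d₂ + C y₃ * X ^ d₃) ^ 2 : ℝ[X])
      = (C (-y₁) * X ^ d₁ + C (-y₂) * X ^ d₂ + C (-y₃) * X ^ d₃) ^ 2 := by
    simp only [map_neg]; ring
  rw [hsq]
  exact countP_posRoots_zp_2_9_le d₁ d₂ d₃ h₁ h₃ σ b₂ b₃ (-y₁) (-y₂) (-y₃) hσ hb₂ hb₃
    (neg_pos.mpr hy₁) (neg_neg_of_pos hy₂) (neg_pos.mpr hy₃)

end Summit.ValiantsHypothesis.ValiantsHypothesis.Theorems.LacunarySymmetroidMatrixDescartes.Census
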